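import Mathlib
import Summits.NavierStokesRegularity.NavierStokesRegularity.Theorems.TaoLadderRungTwoBreakOneShiftWindowGridD
import HarnessLib

/-!
# The one-shift window system, LXVI: TABLE-HOISTED FORM OF THE PRODUCT BOOLEAN — `GridD.prodOKH`, PROVABLY EQUAL to
# the landed `GridD.prodOK` (cell harvest/h2-tao-ladder, seat p2; rung1/RUNG1-P2G16-REPORT.md §82; support for
# K1(1) = `NoSurvivingDSSOne`, stmt-NavierStokesRegularity-20205)

MODEL lattice only (the finite WINDOW system of a Tao-type averaged cascade); nothing here is a statement about the
Navier–Stokes equations; no item is closed; nothing numerical is asserted.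

WHY (evaluation cost, p2 g16): `GridD.prodOK s` (`A_s ⊗ V_s ⊆ V_{s+1}`, part XXXIX) reads each entry of `A_s = [VV_s.lo − Ẑ₂, VV_s.hi + Ẑ₂]`
through `(g.step s).toRoughStepD.centre.vv i l`, and `RoughStepD.centre` BUILDS a `CentreStepD` record — including the squared term data
`sqC n prec RD` — at every one of the `n²` calls inside the `n³` product (compiled code is strict): on the T4W76 replay (`n = 304`) the final-step
test `prodOK 36` ran for more than four hours where the end-matrix form `prodOKE s` (part LVII, hoisted) takes one.  `GridD.AentH` reads
`VV_s` and `Ẑ₂` straight from the step record; `GridD.prodOKH` is `prodOK` with `AentH`; `prodOKH_eq : prodOKH s = prodOK s` holds by `rfl`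
(the two sides are definitionally equal), so a `native_decide` evaluation of `prodOKH s` discharges the landed hypothesis `prodOK s = true`.
-/

noncomputable section

-- the sub-problem namespace repeats the summit name by design (D-0017)
set_option linter.dupNamespace false

namespace Summit.NavierStokesRegularity.NavierStokesRegularity.Theorems

namespace DSSOneShift

open Summit.NavierStokesRegularity.NavierStokesRegularity.Theorems.TaylorModelCert

namespace GridD

variable (g : GridD)

/-- Entry `(i,l)` of `A_s = [VV_s.lo − Ẑ₂, VV_s.hi + Ẑ₂]`, read straight from the step record (no `CentreStepD` is built). [cite: Neumaier1991, §3.1 Proposition 3.1.2 (6); folklore] -/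
def AentH (s i l : ℕ) : IntervalD :=
  ⟨(IntervalD.aget (g.step s).VV (l * (g.step s).n + i)).lo.sub ((g.step s).mget (g.step s).Zh2 i l),
    (IntervalD.aget (g.step s).VV (l * (g.step s).n + i)).hi.add ((g.step s).mget (g.step s).Zh2 i l)⟩

/-- It is the landed entry `Aent`. [folklore] -/
theorem AentH_eq (s i l : ℕ) : g.AentH s i l = g.Aent s i l := rfl

/-- **The product test with hoisted entries**: `A_s ⊗ V_s ⊆ V_{s+1}` computed from `AentH`. [cite: Neumaier1991, §3.1 Proposition 3.1.2 (6); folklore] -/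
def prodOKH (s : ℕ) : Bool :=
  (List.range g.n).all fun i => (List.range g.n).all fun l =>
    IntervalD.subset (IntervalD.rangeSumR g.prec (fun j => IntervalD.mulR g.prec (g.AentH s i j) (g.Vent s j l)) g.n) (g.Vent (s + 1) i l)

/-- **It is the landed Boolean** (definitionally). [folklore] -/
theorem prodOKH_eq (s : ℕ) : g.prodOKH s = g.prodOK s := rfl

end GridD

end DSSOneShift

end Summit.NavierStokesRegularity.NavierStokesRegularity.Theorems
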